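/-
Copyright (c) 2026. All rights reserved.
Released under Apache 2.0 license as described in the file LICENSE.
Authors: abc-iut cell, seat abc-iut-L6-t6 (instance of the Ex. 3.6 (ii) bridge at abc-iut-L6-d1's model of
the places of a number field; `ModelHyps` discharged there by abc-iut-w4-d005, `modelHyps_places`).
-/
import Literature.IUT.LogThetaLattice.GlobalFrobenioidModelsFrobenioid
import Literature.IUT.LogThetaLattice.GlobalFrobenioidModelsPlacesHyps
import HarnessLib

/-!
# [IUTchIII] Example 3.6 (ii) for an actual number field: `𝓕⊛_𝔪𝔬𝔡(F_mod)` is a Frobenioid (no hypotheses)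

S. Mochizuki, *Inter-universal Teichmüller Theory III*, kurims manuscript (May 2020), Example 3.6 (ii),
p. 108 l. 5–11 [claim key Mochizuki2012, status disputed (D-0012)]. `GlobalFrobenioidModelsFrobenioid.lean`
verifies "`𝓕⊛_𝔪𝔬𝔡` admits a natural Frobenioid structure … base category = the one-arrow category …
elementary morphisms = linear morphisms … `n` = the Frobenius degree" over abstract local value groups
`(Γ_v ⊇ Γ_v^{≥0}, β_v)` under `ModelHyps`. Those hypotheses are DISCHARGED at the intended model
(abc-iut-L6-d1, `GlobalFrobenioidModelsPlaces.lean`: `F` a number field, `𝕍` = all places of `F`,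
`Γ_v = ℝ ⊇ ℝ_{≥0}`, `β_v = ord_v` (finite `v`) / `−log |·|_v` (archimedean `v`)) by
`modelHyps_places` (`GlobalFrobenioidModelsPlacesHyps.lean`, abc-iut-w4-d005): the cone `ℝ_{≥0} ⊆ ℝ` is
generating, saturated and sharp, and `β_v(f) = 0` for almost all `v`. HENCE, for the category
`FrakCat F (ModelPlaces F) (fun _ => ℝ) nonnegModel betaModel` of families of local fractional ideals of the
number field, the theorem `isFrobenioid_places`: its structure functor is a Frobenioid in the sense of
[FrdI] Def. 1.3 (abc-iut-found `PreFrobenioid.IsFrobenioid`), a pre-Frobenioid for the divisor monoid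
`Φmod`, of isotropic type — with no residual hypothesis. Classical input only; nothing here takes a side
on [IUTchIII] Cor. 3.12; typed ≠ endorsed.
-/

namespace Literature.IUT.LogThetaLattice

namespace GlobalFrobenioidModels

open CategoryTheory NumberField Literature.AlgebraicGeometry.Frobenioids

variable (F : Type) [Field F] [NumberField F]

/-- **[IUTchIII] Ex. 3.6 (ii) at the model, NO hypotheses**: the structure functor of `𝓕⊛_𝔪𝔬𝔡(F)` (families
of local fractional ideals of the number field `F`, morphisms `(n, f)`) is a FROBENIOID in the sense of
[FrdI] Def. 1.3 over the one-arrow base. ([IUTchIII] Ex 3.6 (ii) p.108) [claim: Mochizuki2012, status: disputed] -/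
theorem isFrobenioid_places : PreFrobenioid.IsFrobenioid (structureFunctor (modelHyps_places F)) :=
  isFrobenioid (modelHyps_places F)

/-- … it is in particular a pre-Frobenioid for the divisor monoid `Φmod` (`v ↦` effective local divisors).
([IUTchIII] Ex 3.6 (ii) p.108) [claim: Mochizuki2012, status: disputed] -/
theorem isPreFrobenioid_places :
    IsPreFrobenioid (Φmod (ModelPlaces F) (fun _ => ℝ) nonnegModel)
      (structureFunctor (modelHyps_places F)) :=
  isPreFrobenioid (modelHyps_places F)

/-- … and it is of isotropic type. ([IUTchIII] Ex 3.6 (ii) p.108) [claim: Mochizuki2012, status: disputed] -/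
theorem isOfIsotropicType_places :
    PreFrobenioid.IsOfIsotropicType (structureFunctor (modelHyps_places F)) :=
  isOfIsotropicType (modelHyps_places F)

end GlobalFrobenioidModels

end Literature.IUT.LogThetaLattice
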